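import Summits.ResolutionOfSingularities.ResolutionOfSingularities.Theorems.FrobeniusClosingSteerCore4SteeredRunExists
import Summits.ResolutionOfSingularities.ResolutionOfSingularities.Theorems.FrobeniusClosingSteerSwitchingAssembly
import Literature.AlgebraicGeometry.Resolution.RsopMonomialIdeals
import Mathlib.Algebra.CharP.Lemmas
import HarnessLib

/-!
# Crux `Steer` (stmt-ResolutionOfSingularities-16345), line `switching_dichotomy` r24: EXIT ⊆ LOG-EXIT — an order-one exit at a
# member is a toroidal log-final presentation (res-L0-w41-strat-1's helper `ExitImpliesLogExit`, census §T)

OURS (campaign `res-hironaka`, rung L ★L-G4, slot W4.1, chain W4.1; seat `res-L0-w41-stub-4` g3; Theses-free, definition-free helper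
for the holder res-L0-w41-lead-1's line `switching_dichotomy`; replaces the role of no printed item; NOT a statement of the
manuscript under review [claim: Hironaka2017, status: under-review]; AI-produced, which is weaker than expert review).

**`exitImpliesLogExit`** (strat-1's `ExitImpliesLogExit`, `L/res-L0-w41-strat-1/Sketch-census-section.lean` §T, with `ExitAt` /
`GenAt` / `OrderOneGen` / `LogExitAt` / `LogFinalAt` / `ToroidalAt` / `ContentInvertible` / `IsFracOf` UNFOLDED and of `CoreDatum`
only the three binders used: `t ^ p ∈ A₀`, regularity at the centre, «`t ^ p` not a `p`-th power at the centre»). If a subring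
`S ⊆ O` containing `A₀` and consisting of fractions of `A₀` carries a generator `s'` of the torsor of `t` in ORDER-ONE form
(`s' ^ p − g ^ p = z₀` a one-element part of a regular system of parameters, `g ∈ S`), then `S` is LOG-FINAL of type E2 for
`t`: the exchanged radicand `t₂ := s' − g` is not a fraction of `A₀` (else `t ∈ S[s'] ⊆ Frac A₀`, impossible by normality of the
base at the centre — `SteeredRun.not_mem_closure_of_ne_pow`, p499045) and `t₂ ^ p = z₀ = z₀ ^ 1 · 1` is toroidal with the exponent
`1`, prime to `p`. Hence the binders `∀ M, ¬ ExitAt (R M) p t` / `NoExitModel` of S3ᴹ / NSCᴹ carry no information beyond the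
log-final silence (holder may drop them at a reshape; res-D-pv-028 CONCUR 07:28:11Z). [folklore]
-/

-- `Summit.<S>.<S>.…` duplicates the summit name by design (single-problem summit).
set_option linter.dupNamespace false

open IsLocalRing
open Literature.AlgebraicGeometry.Resolution

namespace Summit.ResolutionOfSingularities.ResolutionOfSingularities.Theorems.SwitchingDichotomy

namespace EventualMonomial

variable {k K : Type} [Field k] [Field K] [Algebra k K]

/-- **Exit ⊆ log-exit** (strat-1's `ExitImpliesLogExit`, vocabulary unfolded; `CoreDatum` reduced to the binders used).
[folklore] -/
theorem exitImpliesLogExit (p : ℕ) (hp : p.Prime) [CharP k p] (O : ValuationSubring K) (A₀ : Subalgebra k K)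
    (h₀ : A₀.toSubring ≤ O.toSubring) (t : K) (htp : t ^ p ∈ A₀)
    (hreg : IsRegularLocalRing (Localization.AtPrime
      (Ideal.comap (Subring.inclusion h₀) (IsLocalRing.maximalIdeal O))))
    (hc : ∀ c : Localization.AtPrime (Ideal.comap (Subring.inclusion h₀) (IsLocalRing.maximalIdeal O)),
      algebraMap A₀.toSubring (Localization.AtPrime (Ideal.comap (Subring.inclusion h₀)
        (IsLocalRing.maximalIdeal O))) ⟨t ^ p, htp⟩ ≠ c ^ p)
    (S : Subring K) (_hA : A₀.toSubring ≤ S) (_hSO : S ≤ O.toSubring)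
    (hSfrac : ∀ x ∈ S, ∃ y ∈ A₀, ∃ z ∈ A₀, z ≠ 0 ∧ x = y / z)
    (hexit : ∃ s' : K, (s' ^ p ∈ S ∧ t ∈ Subring.closure (insert s' (S : Set K))) ∧
      ∃ g ∈ S, ∃ (_ : IsLocalRing S) (z : Fin 1 → S), IsRsopPart z ∧ ((z 0 : S) : K) = s' ^ p - g ^ p) :
    ∃ (_ : IsLocalRing S),
      ((∃ f' : S, (f' : K) = t ^ p ∧
          ∃ h : S, h ≠ 0 ∧ (∀ δ : Derivation ℤ S S, h ∣ δ f') ∧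
            ∃ (δ : Derivation ℤ S S) (u : S), IsUnit u ∧ δ f' = h * u) ∨
        (∃ t₂ : K, ¬ (∃ y ∈ A₀, ∃ z ∈ A₀, z ≠ 0 ∧ t₂ = y / z) ∧
          ∃ (n : ℕ) (z : Fin n → S), IsRsopPart z ∧ ∃ (m : Fin n → ℕ), (∃ l, ¬ p ∣ m l) ∧
            ∃ u : S, IsUnit u ∧ t₂ ^ p = (∏ l, ((z l : S) : K) ^ m l) * (u : K))) := by
  classical
  haveI : Fact p.Prime := ⟨hp⟩
  haveI : CharP K p := charP_of_injective_algebraMap (algebraMap k K).injective p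
  obtain ⟨s', ⟨hs'S, ht⟩, g, hgS, hloc, z, hz, hz0⟩ := hexit
  refine ⟨hloc, Or.inr ⟨s' - g, ?_, 1, z, hz, fun _ => 1, ⟨0, ?_⟩, 1, isUnit_one, ?_⟩⟩
  · -- `s' - g ∉ Frac A₀`: otherwise `s' ∈ Frac A₀` and `t ∈ S[s'] ⊆ Frac A₀`
    intro hfrac
    set F : Subfield K := Subfield.closure (A₀ : Set K)
    have hSF : (S : Set K) ⊆ F := fun x hx => (exists_div_iff_mem_closure A₀ x).mp (hSfrac x hx)
    have hs'F : s' ∈ F := by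
      have h1 : s' - g ∈ F := (exists_div_iff_mem_closure A₀ _).mp hfrac
      have h2 : g ∈ F := hSF hgS
      simpa using add_mem h1 h2
    have htF : t ∈ F := by
      refine (Subring.closure_le (t := F.toSubring)).mpr ?_ ht
      exact Set.insert_subset hs'F hSF
    exact SteeredRun.not_mem_closure_of_ne_pow O A₀ h₀ hp.ne_zero t htp hreg hc htF
  · -- the exponent `1` is prime to `p`
    rw [Nat.dvd_one]
    exact hp.one_lt.ne'
  · -- `(s' - g) ^ p = z₀ = z₀ ^ 1 * 1`
    rw [sub_pow_char, ← hz0]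
    simp

end EventualMonomial

end Summit.ResolutionOfSingularities.ResolutionOfSingularities.Theorems.SwitchingDichotomy
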